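import Literature.AlgebraicGeometry.Resolution.PointBlowupAdaptedOrder
import Mathlib.Algebra.CharP.Lemmas

/-!
# The Artin–Schreier layer `h = X^p − g^{p−1} X + f` of the point-blowup walk (statement-level typing)

`PointBlowupShade` / `PointBlowupAdaptedOrder` type the walk for the purely inseparable equation
`x^q + F(y)` (Cossart–Piltant's assumption **(G)** with `G = 0`).  This file types, at the same
statement level and in the SAME given coordinates `(u_1, …, u_n)`, the objects of
[Cossart–Piltant 2009, chapter 1] for the ARTIN–SCHREIER / purely inseparable form

  `h = X^p − g^{p−1} X + f`,  `f, g ∈ S`,  `g = (unit) × u^β` supported on the boundary `E`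

(ch.1 (1) and **I** (1)–(2); the case `g = 0` is the purely inseparable one), namely

* the state `(f, g, β)` and the translation `Z := X − θ`, `f_Z = f + θ^p − θ g^{p−1}` (**II.3**), with
  the ring identity behind it PROVED (`artinSchreier_translate`);
* the generating points of the polyhedron `Δ(h; u; X)` scaled by `p` (`supp f ∪ {p β}`), vertices and
  SOLVABLE vertices (**II.2.1**), minimality (**II.2.2**);
* `p·δ(x) = min (ord f, p·ord g)` (**II.1.1**), `p·d_i = min (a_i, p β_i)` and `|H(x)|` (**II.1.2**),
  `ε(x) = p δ(x) − Σ_{i∈E} p d_i` (**II.3.3**), the log-Jacobian orders `ν(x) = ord J(f,E)`,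
  `α(x) = ord J(f,E,x)` in the given regular system of parameters (**II.3**);
* the case split (i)–(v) of **II.3.3 / II.4** and the pair `Ω = (ω, ω')`, where the infimum over "all
  r.s.p.'s with `Δ` minimal" of **II.4** is typed over the translations `Z = X − θ` with the Newton
  polyhedron of `θ` inside `Δ(h;u;X)` for the FIXED parameters `u` (`omegaU`, `OmegaPrimeU`) — CP's
  `ω(x)` is `≤ omegaU` and the atlas records this restriction as a convention (freedom F13-U);
* the chart / point transform of a point blow-up for the triple `(f, g, β)` (**II.5.4** (1) read at a
  closed point of the first chart: `h' = X'^p − X' g'^{p−1} + f'`, `f' = f∘σ / u_j^p`, `g' = g∘σ / u_j`),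
  the transported boundary `E' = (e⁻¹E)_red` (`PointBlowup.newBoundary`), "prepared transform"
  (`∃ θ`, minimal), membership in `Σ_p` (`δ ≥ 1`), and the row-wise TEST predicates of the atlas:
  `EpsIncreasesAt` ("Artin–Schreier kangaroo"), `OnStrictTransformX` / `StrictTransformTestAt` /
  `ChildHNeOneTestAt` (**II.5.3**) and `OmegaNonIncreaseAt` (**II.5.4**: "`Ω(x') ≤ Ω(x)`"
  for `x' ∈ Σ_p` above a closed point with `ω(x) ≥ 1`, `H(x) ≠ 1`) — PREDICATES, never asserted;
* the bridge to the `G = 0` layer: with `g = 0` the numbers `p·d_i`, `p·δ`, `ε` of this file are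
  `PointBlowup.bigH`, `ord₀ F`, `PointBlowup.epsilon` (`pd_of_g_zero`, `epsilonAS_of_g_zero`).

What is NOT here: the invariance statements themselves (II.2, II.3.3, II.4.4), the centres of the second
kind and `τ`, `κ` (II.4, II.5.1, II.6), changes of the parameters `u` inside the infimum of II.4, and any
claim about termination.  The computable twin with the census rows is the carver-g13 packet of the cell.
-/

open MvPolynomial Finset

open scoped BigOperators

noncomputable section

namespace Literature.AlgebraicGeometry.Resolution

open Literature.AlgebraicGeometry.Resolution.Hauser2010
open Literature.AlgebraicGeometry.Resolution.HauserPerlega2019 (initialForm)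

namespace PointBlowup

namespace ArtinSchreier

variable {σ : Type*} {K : Type*} [CommRing K]

/-! ### The translation law `Z := X − θ` -/

/-- The ring identity behind "if we change `X` to `Z = X − θ`, `θ ∈ S`, `f` is changed into
`f_Z = f + θ^p − θ g^{p−1}`": in characteristic `p`,
`(Z + θ)^p − g^{p−1}(Z + θ) + f = Z^p − g^{p−1} Z + (f + θ^p − θ g^{p−1})`.
[cite: CossartPiltant2009, ch.1 II.3 (f_Z = f + θ^p − θ g^{p−1})] -/
theorem artinSchreier_translate {R : Type*} [CommRing R] (p : ℕ) [Fact p.Prime] [CharP R p]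
    (Z θ f g : R) :
    (Z + θ) ^ p - g ^ (p - 1) * (Z + θ) + f = Z ^ p - g ^ (p - 1) * Z + (f + θ ^ p - θ * g ^ (p - 1)) := by
  rw [add_pow_char]
  ring

/-! ### The state `(f, g, β)` -/

/-- A **state** of the Artin–Schreier walk in given parameters `u`: the pair `(f, g)` of
`h = X^p − g^{p−1} X + f ∈ S[X]` together with the exponent `β` of the monomial part of
`g = γ ∏ u_i^{β_i}`, `γ` a unit (**I** (1)); `g = 0` (then `β` is irrelevant, conventionally `0`) is the
purely inseparable case `h = X^p + f`. [cite: CossartPiltant2009, ch.1 (1) and I (1)] -/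
structure State (σ : Type*) (K : Type*) [CommRing K] where
  /-- the constant term `f ∈ S` of `h` -/
  f : MvPolynomial σ K
  /-- the coefficient `g` of `−g^{p−1} X` (`0` in the purely inseparable case) -/
  g : MvPolynomial σ K
  /-- the exponent `β` of the monomial part of `g = γ u^β` -/
  β : σ →₀ ℕ

/-- `g = γ u^β` with `γ(0) ≠ 0` (a unit of `S = k[u]_{(u)}`), and the components of `u^β` belong to the
boundary: "`g = γ ∏_{div(u_i) ⊆ E} u_i^{β_i}`, `γ` invertible".  With `g = 0` only `β = 0` is asked.
[cite: CossartPiltant2009, ch.1 I (1)] -/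
def WellFormed (E : Finset σ) (s : State σ K) : Prop :=
  (s.g = 0 ∧ s.β = 0) ∨
    ((∃ γ : MvPolynomial σ K, s.g = monomial s.β 1 * γ ∧ constantCoeff γ ≠ 0) ∧ s.β.support ⊆ E)

/-- The translation `Z := X − θ`: `(f, g, β) ↦ (f + θ^p − θ g^{p−1}, g, β)`.
[cite: CossartPiltant2009, ch.1 II.3 (f_Z = f + θ^p − θ g^{p−1})] -/
def translateX (p : ℕ) (θ : MvPolynomial σ K) (s : State σ K) : State σ K where
  f := s.f + θ ^ p - θ * s.g ^ (p - 1)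
  g := s.g
  β := s.β

/-- The translations `Z := X − θ` form an action of the additive group of `S`: translating by `θ₂`
and then by `θ₁` is translating by `θ₁ + θ₂` (additivity of Frobenius in characteristic `p`).  This is
why a preparation — any finite sequence of vertex translations (II.2.2) — is a single translation, as
`IsPreparedTransformAt` below records it. [cite: CossartPiltant2009, ch.1 II.3 (f_Z = f + θ^p − θ g^{p−1})] -/
theorem translateX_translateX (p : ℕ) [Fact p.Prime] [CharP K p] (θ₁ θ₂ : MvPolynomial σ K)
    (s : State σ K) : translateX p θ₁ (translateX p θ₂ s) = translateX p (θ₁ + θ₂) s := by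
  simp only [translateX, State.mk.injEq, and_true]
  rw [add_pow_char]
  ring

/-- Translating by `0` does nothing. [cite: CossartPiltant2009, ch.1 II.3 (f_Z = f + θ^p − θ g^{p−1})] -/
theorem translateX_zero (p : ℕ) (hp : p ≠ 0) (s : State σ K) : translateX p 0 s = s := by
  cases s
  simp [translateX, zero_pow hp]

/-- In the purely inseparable case the translation is Hauser's cleaning move `F ↦ F + θ^p`.
[cite: CossartPiltant2009, ch.1 II.3 (case g = 0: J(f,E) = J(f_Z,E))] -/
theorem translateX_f_of_g_zero (p : ℕ) (hp : 2 ≤ p) (θ : MvPolynomial σ K) (s : State σ K)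
    (hg : s.g = 0) : (translateX p θ s).f = s.f + θ ^ p := by
  have h1 : p - 1 ≠ 0 := by omega
  simp [translateX, hg, zero_pow h1]

/-! ### The polyhedron `Δ(h; u; X)` through its generating points (scaled by `p`) -/

/-- The generating points of `p · Δ(h; u_1, …, u_n; X)`: the exponents of `f` (the monomial `u^a` of `f`
gives the point `a / p`) and, if `g ≠ 0`, the point `p β` (the term `−γ^{p−1} u^{(p−1)β} X` gives the point
`β`; the other monomials of `γ^{p−1} u^{(p−1)β}` lie above it).  `Δ` is the positive convex hull of these
points divided by `p`. [cite: CossartPiltant2009, ch.1 II.1 (Δ(h;u;X) = projection of 1/p times the Newton polyhedron)] -/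
def points [DecidableEq σ] (p : ℕ) (s : State σ K) : Finset (σ →₀ ℕ) :=
  haveI := Classical.dec (s.g = 0)
  if s.g = 0 then s.f.support else insert (p • s.β) s.f.support

/-- Membership of an (integer) point `x` in the positive convex hull `conv(P) + ℝ^n_{≥0}` of a finite
point set `P`, by duality: every non-negative linear form takes on `x` a value at least its minimum on
`P`. [cite: Hironaka1967, §1 (the polyhedron Δ as a positively convex set)] -/
def InPolyhedron [DecidableEq σ] (P : Finset (σ →₀ ℕ)) (x : σ →₀ ℕ) : Prop :=
  ∀ L : σ → ℚ, (∀ i, 0 ≤ L i) → ∃ q ∈ P, ∑ i ∈ q.support ∪ x.support, L i * (q i : ℚ) ≤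
    ∑ i ∈ q.support ∪ x.support, L i * (x i : ℚ)

/-- **Vertex** of the polyhedron generated by `P`: a point of `P` that is the strict minimum of some
POSITIVE linear form on `P` ("`v` is a vertex … if there exists a positive linear form `L` such that
…"). [cite: Hironaka1967, §1 (vertices of Δ)] -/
def IsVertex [DecidableEq σ] (P : Finset (σ →₀ ℕ)) (v : σ →₀ ℕ) : Prop :=
  v ∈ P ∧ ∃ L : σ → ℚ, (∀ i, 0 < L i) ∧ ∀ w ∈ P, w ≠ v →
    ∑ i ∈ v.support ∪ w.support, L i * (v i : ℚ) < ∑ i ∈ v.support ∪ w.support, L i * (w i : ℚ)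

/-- **Solvable vertex** (read over a field, algorithmic form of II.2.1–II.2.2): a vertex `a` of
`Δ(h;u;X)` — here the scaled point `v = p a` — which is NOT the point of `g` and whose initial form is a
`p`-th power, i.e. `v ∈ p ℕ^n` is an exponent of `f` with coefficient a `p`-th power `λ^p`; then
`in_v(h) = X^p + λ^p U^{pa} = (X + λ U^a)^p` and the translation `Z := X + λ u^a` dissolves the vertex.
"If `Σ ε_x U^{(p−1)x} ≠ 0` [the `g`-term contributes to `in_v h`], `v` is not solvable."
[cite: CossartPiltant2009, ch.1 II.2.1 (proof: solvable vertices and initial forms)] -/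
def IsSolvableVertex [DecidableEq σ] (p : ℕ) (s : State σ K) (v : σ →₀ ℕ) : Prop :=
  IsVertex (points p s) v ∧ (s.g ≠ 0 → v ≠ p • s.β) ∧ (∀ i, p ∣ v i) ∧ ∃ c : K, coeff v s.f = c ^ p

/-- `Δ(h; u; X)` is **minimal** (in `X`, for the given `u`): no vertex is solvable — the outcome of the
vertex preparation "ψ_v … obtained by induction on `v`" of II.2.2 (with `N = ∞`), Hironaka's criterion.
[cite: CossartPiltant2009, ch.1 II.2.2] -/
def IsMinimal [DecidableEq σ] (p : ℕ) (s : State σ K) : Prop :=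
  ∀ v, ¬ IsSolvableVertex p s v

/-! ### `p·δ`, `p·d_i`, `H`, `ε`, `ν`, `α` in the given parameters -/

/-- `p · δ(x)` with `δ(x) := inf {ord g, ord f / p} ∈ (1/p)ℕ` (for `Δ` minimal): `min (ord₀ f, p · ord₀ g)`,
`ord₀ g = |β|`; `⊤`-conventions of `ℕ∞` (`g = 0` drops the second term).
[cite: CossartPiltant2009, ch.1 II.1.1] -/
def pdelta (p : ℕ) (s : State σ K) : ℕ∞ :=
  haveI := Classical.dec (s.g = 0)
  min (ordZero s.f) (if s.g = 0 then ⊤ else ((p * s.β.degree : ℕ) : ℕ∞))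

/-- `p · d_i(x)` with `d_i(x) := inf {β_i, a_i / p}` for `div(u_i) ⊆ E_x`, `a_i` = the exponent of `u_i`
in the monomial part of `f` (**I** (2)), i.e. `min (H_i(f), p β_i)` with `H_i(f) = PointBlowup.bigH f i`.
[cite: CossartPiltant2009, ch.1 II.1.2] -/
def pd (p : ℕ) (s : State σ K) (i : σ) : ℕ∞ :=
  haveI := Classical.dec (s.g = 0)
  min (bigH s.f i) (if s.g = 0 then ⊤ else ((p * s.β i : ℕ) : ℕ∞))

/-- `ord H(x) = Σ_{div(u_i) ⊆ E_x} p d_i(x)`, `H(x) := ∏ u_i^{p d_i(x)}`.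
[cite: CossartPiltant2009, ch.1 II.1.2] -/
def bigHdeg (p : ℕ) (E : Finset σ) (s : State σ K) : ℕ∞ :=
  ∑ i ∈ E, pd p s i

/-- `H(x) = 1`, i.e. every `d_i(x) = 0` — the excluded case of II.5.3 (i) / II.5.4.
[cite: CossartPiltant2009, ch.1 II.5.4 (hypothesis H(x) ≠ 1)] -/
def HIsOne (p : ℕ) (E : Finset σ) (s : State σ K) : Prop :=
  bigHdeg p E s = 0

/-- `ε(x) = p (δ(x) − Σ_{div(u_i) ⊆ E_x} d_i)` ("the equality `ord H(x) + ε(x) = p δ(x)` is clear from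
the definitions"); `ℕ∞` subtraction. [cite: CossartPiltant2009, ch.1 II.3.3] -/
def epsilonAS (p : ℕ) (E : Finset σ) (s : State σ K) : ℕ∞ :=
  pdelta p s - bigHdeg p E s

/-- `ord_x (H(x)^{−1} g^p) = p ord g − ord H(x)` (`⊤` if `g = 0`), the second member of the infimum
defining `ε` and `ω`. [cite: CossartPiltant2009, ch.1 II.3 (ε(x) := inf{ord J(f,E,x), ord H^{-1} g^p})] -/
def hgOrder (p : ℕ) (E : Finset σ) (s : State σ K) : ℕ∞ :=
  haveI := Classical.dec (s.g = 0)
  (if s.g = 0 then ⊤ else ((p * s.β.degree : ℕ) : ℕ∞)) - bigHdeg p E s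

/-- The order of the Jacobian ideal `𝒥(f, E) = (𝒟 f)`, `𝒟 = Σ_{div(u_i) ⊆ E} S u_i ∂/∂u_i +
Σ_{div(u_j) ⊄ E} S ∂/∂u_j` (derivations logarithmic along `E`; over a perfect ground field there are no
derivations relative to constants), in the given parameters: the least order of a generator.
[cite: CossartPiltant2009, ch.1 II.3 (3) and 𝒥(f,E)_z := (𝒟 f) S_z] -/
def jacOrder [Fintype σ] [DecidableEq σ] (E : Finset σ) (f : MvPolynomial σ K) : ℕ∞ :=
  min (E.inf fun i => ordZero (X i * pderiv i f)) ((univ \ E).inf fun j => ordZero (pderiv j f))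

/-- The order of `𝒥(f, E, x) = (𝒟(x) f)` at the closed point: the non-boundary derivations are
multiplied by the maximal ideal (II.3 (5)), which raises their order by one.
[cite: CossartPiltant2009, ch.1 II.3 (5)] -/
def jacOrderAt [Fintype σ] [DecidableEq σ] (E : Finset σ) (f : MvPolynomial σ K) : ℕ∞ :=
  min (E.inf fun i => ordZero (X i * pderiv i f)) ((univ \ E).inf fun j => ordZero (pderiv j f) + 1)

/-- `ν(x) := ord_x J(f, E)`, `J(f,E) = H(x)^{−1} 𝒥(f,E)`, computed in the GIVEN regular system of
parameters (CP: "all of these ideals depend on a choice of the variable `X`").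
[cite: CossartPiltant2009, ch.1 II.3 (ν(x) := ord_x J(f,E))] -/
def nuAS [Fintype σ] [DecidableEq σ] (p : ℕ) (E : Finset σ) (s : State σ K) : ℕ∞ :=
  jacOrder E s.f - bigHdeg p E s

/-- `α(x) := ord_x J(f, E, x)` in the given parameters. [cite: CossartPiltant2009, ch.1 II.3 (α(x) := ord_x J(f,E,x))] -/
def alphaAS [Fintype σ] [DecidableEq σ] (p : ℕ) (E : Finset σ) (s : State σ K) : ℕ∞ :=
  jacOrderAt E s.f - bigHdeg p E s

/-- `ε(x) := inf {ord_x J(f,E,x), ord_x (H(x)^{−1} g^p)}` — the DEFINITION of II.3, of which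
`epsilonAS` is the value asserted by II.3.3; the atlas checks the two agree row by row.
[cite: CossartPiltant2009, ch.1 II.3 (definition of ε(x))] -/
def epsilonDef [Fintype σ] [DecidableEq σ] (p : ℕ) (E : Finset σ) (s : State σ K) : ℕ∞ :=
  min (alphaAS p E s) (hgOrder p E s)

/-! ### The case split of II.3.3 / II.4 and `Ω = (ω, ω')` over translations of `X` -/

/-- `v_δ(g) = 1`: the point `β` of `g` lies on the initial face, `ord g = δ(x)` (`g ≠ 0`).
[cite: CossartPiltant2009, ch.1 II.3.3 (i) (v_δ(g) = 1)] -/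
def GTight (p : ℕ) (s : State σ K) : Prop :=
  s.g ≠ 0 ∧ ((p * s.β.degree : ℕ) : ℕ∞) = pdelta p s

/-- `v_δ(f) = p`: `ord f = p δ(x)` (otherwise `v_δ(f) > p`). [cite: CossartPiltant2009, ch.1 II.3.3 (i) (v_δ(f) = p)] -/
def FTight (p : ℕ) (s : State σ K) : Prop :=
  ordZero s.f = pdelta p s

/-- `Φ := cl_{pδ(x)} f ∈ k(x)[{U_i | div(u_i) ⊆ E}]`: the initial form of `f` (relevant when `v_δ(f) = p`)
involves boundary variables only. [cite: CossartPiltant2009, ch.1 II.3.3 (Φ ∈ k(x)[U_i, div(u_i) ⊆ E])] -/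
def PhiInBoundary (E : Finset σ) (s : State σ K) : Prop :=
  ∀ d ∈ (initialForm s.f).support, d.support ⊆ E

/-- `Φ ∈ k(x)[{U_i, U_j^p | div(u_i) ⊆ E, div(u_j) ⊄ E}]` — the membership that separates cases (iv) and
(v) of II.4 (non-boundary variables occur in `Φ` only through `p`-th powers).
[cite: CossartPiltant2009, ch.1 II.4 (iv)–(v)] -/
def PhiInBoundaryUpToPth (p : ℕ) (E : Finset σ) (s : State σ K) : Prop :=
  ∀ d ∈ (initialForm s.f).support, ∀ j, j ∉ E → p ∣ d j

/-- Case (i) of II.3.3 / II.4: `v_δ(g) = 1`, and either `v_δ(f) > p` or (`v_δ(f) = p` and `Φ ∈ k(x)[U_E]`);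
then `Ω(x) = (ε(x), 1)`. [cite: CossartPiltant2009, ch.1 II.4 (i)] -/
def CaseI (p : ℕ) (E : Finset σ) (s : State σ K) : Prop :=
  GTight p s ∧ (¬ FTight p s ∨ PhiInBoundary E s)

/-- Case (ii): `v_δ(g) > 1` (this includes `g = 0`); then `Ω(x) = (ν(x), 2)` and `ν(x)` is independent
of the r.s.p. [cite: CossartPiltant2009, ch.1 II.4 (ii)] -/
def CaseII (p : ℕ) (s : State σ K) : Prop :=
  ¬ GTight p s

/-- The zone of cases (iii)–(v): `v_δ(g) = 1`, `v_δ(f) = p`, `Φ ∉ k(x)[U_E]`.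
[cite: CossartPiltant2009, ch.1 II.4 (iii)–(v)] -/
def TightZone (p : ℕ) (E : Finset σ) (s : State σ K) : Prop :=
  GTight p s ∧ FTight p s ∧ ¬ PhiInBoundary E s

/-- The translations of `X` that keep `Δ(h; u; X)` (and its minimality): `Z := X − θ` with the Newton
polyhedron of `θ` inside `Δ(h;u;X)` — every exponent `a` of `θ` has `p a ∈ p Δ` ("we can replace `X` by
any `Z := X − θ` such that the Newton polyhedron of `θ` is a subset of `Δ(h;u;X)` and get
`Δ(h;u;Z) = Δ(h;u;X)`"). [cite: CossartPiltant2009, ch.1 II.3.3 (proof, admissible translations Z := X − θ)] -/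
def AdmissibleTheta [DecidableEq σ] (p : ℕ) (s : State σ K) (θ : MvPolynomial σ K) : Prop :=
  ∀ a ∈ θ.support, InPolyhedron (points p s) (p • a)

/-- `ω` over the translations of `X` for FIXED parameters `u`:
`inf_θ ord (J(f_Z, E), H(x)^{−1} g^p)` over admissible `θ`.  CP's `ω(x)` (II.4) takes the infimum over all
r.s.p.'s `(X, u_1, …, u_n)` with `E_x ⊆ div(u_1⋯u_n)` and `Δ` minimal, hence `ω(x) ≤ omegaU`; the atlas
records the restriction to fixed `u` as a convention. [cite: CossartPiltant2009, ch.1 II.4 (definition of ω(x))] -/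
def omegaU [Fintype σ] [DecidableEq σ] (p : ℕ) (E : Finset σ) (s : State σ K) : ℕ∞ :=
  ⨅ θ : {θ : MvPolynomial σ K // AdmissibleTheta p s θ}, min (nuAS p E (translateX p θ.1 s)) (hgOrder p E s)

/-- `ω'(x) ∈ {1, 2, 3}` over the same family of translations: `1` if `ω = ord(H^{−1} g^p)`; otherwise `3` if
SOME admissible translation has `ord J(f_Z, E) = 1 + ω` (the ambiguous case (iii)), else `2`.
[cite: CossartPiltant2009, ch.1 II.4 (definition of ω'(x))] -/
def OmegaPrimeU [Fintype σ] [DecidableEq σ] (p : ℕ) (E : Finset σ) (s : State σ K) : ℕ :=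
  haveI := Classical.dec
  if omegaU p E s = hgOrder p E s then 1
  else if ∃ θ : MvPolynomial σ K, AdmissibleTheta p s θ ∧ nuAS p E (translateX p θ s) = omegaU p E s + 1
    then 3 else 2

/-- `Ω(x) = (ω(x), ω'(x))`, compared lexicographically, over translations of `X` for fixed `u`.
[cite: CossartPiltant2009, ch.1 II.4 (Ω(x) := (ω(x), ω'(x)))] -/
def OmegaU [Fintype σ] [DecidableEq σ] (p : ℕ) (E : Finset σ) (s : State σ K) : ℕ∞ ×ₗ ℕ :=
  toLex (omegaU p E s, OmegaPrimeU p E s)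

/-! ### One point blow-up for `(f, g, β)` and the test predicates of the atlas -/

/-- The `(f, g, β)` seen at the point `b` (`b_j = 0`) of the `u_j`-chart of the blow-up of the closed
point, BEFORE the translation on `X'`: `f' = f∘σ / u_j^p`, `g' = g∘σ / u_j` (so that
`h / u_j^p = X'^p − g'^{p−1} X' + f'`, `X = X' u_j`), moved to `b`; the monomial part of `g'` keeps
`β_i` on the components through the point, gets `|β| − 1` on the new one and loses the components
`u_i`, `b_i ≠ 0` (their factor joins the unit). [cite: CossartPiltant2009, ch.1 II.5.4 (1) (h' = X'^p − X' g'^{p−1} + f')] -/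
def pointAS [DecidableEq σ] [DecidableEq K] (p : ℕ) (j : σ) (b : σ → K) (s : State σ K) : State σ K where
  f := translate b (chartTransform p j s.f)
  g := translate b (chartTransform 1 j s.g)
  β := (chartExponent 1 j s.β).filter fun i => b i = 0

/-- At the point `b` the coefficient `g'` is a unit (`g'(b) ≠ 0`): then `h'` is étale in `X'` over `S'`
and the point above is regular — not in `Σ_p`. [cite: CossartPiltant2009, ch.1 I (Σ_p ⊆ η^{-1}(E_0), E_0 ⊇ div(g))] -/
def EtaleAt [DecidableEq σ] [DecidableEq K] (p : ℕ) (j : σ) (b : σ → K) (s : State σ K) : Prop :=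
  constantCoeff (pointAS p j b s).g ≠ 0

/-- **Prepared transform** at the point: some translation `Z' := X' − θ` of the point transform whose
polyhedron `Δ(h'; u'; Z')` is minimal (II.2.2 applied at `x'`; the constant of `f'` is absorbed by a
constant `θ`). [cite: CossartPiltant2009, ch.1 II.2.2] -/
def IsPreparedTransformAt [DecidableEq σ] [DecidableEq K] (p : ℕ) (j : σ) (b : σ → K)
    (s s' : State σ K) : Prop :=
  ∃ θ : MvPolynomial σ K, s' = translateX p θ (pointAS p j b s) ∧ IsMinimal p s'

/-- `x ∈ Σ_p` (multiplicity `p`) for a state with `Δ` minimal and `g(0) = 0`: `δ(x) ≥ 1`, i.e.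
`p ≤ p δ(x)`. [cite: CossartPiltant2009, ch.1 II (x_0 ∈ Σ_p) and II.1.1] -/
def InSigmaP [DecidableEq σ] (p : ℕ) (s : State σ K) : Prop :=
  IsMinimal p s ∧ constantCoeff s.g = 0 ∧ (p : ℕ∞) ≤ pdelta p s

/-- **`ε` increases** at the point `b` of chart `u_j` ("Artin–Schreier kangaroo" of the atlas): some
prepared transform in `Σ_p` has larger `ε`, the boundary being transported as `E' = (e⁻¹E)_red`
(`PointBlowup.newBoundary`).  By II.3.3 `ε(x')` does not depend on the prepared transform chosen.
[cite: CossartPiltant2009, ch.1 II.3.3 and II.5.4] -/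
def EpsIncreasesAt [DecidableEq σ] [DecidableEq K] (p : ℕ) (j : σ) (b : σ → K) (E : Finset σ)
    (s : State σ K) : Prop :=
  ∃ s', IsPreparedTransformAt p j b s s' ∧ InSigmaP p s' ∧
    epsilonAS p E s < epsilonAS p (newBoundary j b E) s'

/-- **II.5.4 as a row-wise test**: "Assume that `x_0 ∈ Σ_p`, `ω(x_0) ≥ 1` and `H(x_0) ≠ 1`. Let
`e : X_1 → X_0` be the blowing up along `x_0` and `x' ∈ e^{−1}(x_0)` be a closed point. If `x' ∈ Σ_p(X_1)`,
then `Ω(x') ≤ Ω(x_0)`, where `Ω(x')` is computed w.r.t. `E' := e^{−1}(E)_red`."  Here with `Ω` over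
translations of `X` for fixed parameters on both sides — a PREDICATE the atlas evaluates, not a theorem
of this file. [cite: CossartPiltant2009, ch.1 II.5.4 Theorem] -/
def OmegaNonIncreaseAt [Fintype σ] [DecidableEq σ] [DecidableEq K] (p : ℕ) (j : σ) (b : σ → K)
    (E : Finset σ) (s : State σ K) : Prop :=
  (1 : ℕ∞) ≤ omegaU p E s → ¬ HIsOne p E s →
    ∀ s', IsPreparedTransformAt p j b s s' → InSigmaP p s' →
      OmegaU p (newBoundary j b E) s' ≤ OmegaU p E s

/-- `x'` lies **on the strict transform of `{X = 0}`**.  In the chart `u_j` at the point `b`, when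
`g'(b) = 0` the closed point of `X_1` above is `(X' = λ, u' = b)` with `λ^p = −f'(b)`; it lies on
`{X' = 0}` iff `f'(b) = 0`, i.e. iff no constant has to be absorbed into `X'` before preparing.
[cite: CossartPiltant2009, ch.1 II.5.3 (i) ("x' lies on the strict transform of {X = 0}")] -/
def OnStrictTransformX [DecidableEq σ] [DecidableEq K] (p : ℕ) (j : σ) (b : σ → K)
    (s : State σ K) : Prop :=
  constantCoeff (pointAS p j b s).f = 0

/-- **II.5.3 (i) as a row-wise test** (centre = the closed point `x_0`): "Assume that `x_0 ∈ Σ_p` and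
that `ω(x_0) ≥ 1` … (i) if `H(x_0) ≠ 1` and `x' ∈ Σ_p(X_1)`, then `x'` lies on the strict transform of
`{X = 0}`, whenever `Y` is expressed as `Y = V(X, {u_i}_{i∈I})`, with `E ⊆ div(u_1u_2u_3)` and
`Δ(h; u_1, u_2, u_3; X)` minimal" — the proof is "an easy consequence of [H2, thm. 3, p. 331]".
A PREDICATE the atlas evaluates, not a theorem of this file. [cite: CossartPiltant2009, ch.1 II.5.3 Proposition (i)] -/
def StrictTransformTestAt [Fintype σ] [DecidableEq σ] [DecidableEq K] (p : ℕ) (j : σ) (b : σ → K)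
    (E : Finset σ) (s : State σ K) : Prop :=
  (1 : ℕ∞) ≤ omegaU p E s → ¬ HIsOne p E s → IsMinimal p s →
    (∃ s', IsPreparedTransformAt p j b s s' ∧ InSigmaP p s') → OnStrictTransformX p j b s

/-- **`H(x') ≠ 1` above a point centre** — the proof of II.5.3 (ii) in the case `Y = x_0`
(`δ(y) = δ(x_0) ≥ 1`): "If `δ(y) > 1`, we have `(f', g') ⊆ (t)` so `H(x') ≠ 1`. If
`δ(y) = δ(x_0) = 1`, … `u_1/t` is a regular parameter at `x'` and divides `H(x')`, hence `H(x') ≠ 1`."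
As a row-wise test with `E' = (e⁻¹E)_red`; a PREDICATE the atlas evaluates, not a theorem of this file.
[cite: CossartPiltant2009, ch.1 II.5.3 Proposition (ii), proof (case δ(y) = δ(x_0))] -/
def ChildHNeOneTestAt [Fintype σ] [DecidableEq σ] [DecidableEq K] (p : ℕ) (j : σ) (b : σ → K)
    (E : Finset σ) (s : State σ K) : Prop :=
  (1 : ℕ∞) ≤ omegaU p E s → ¬ HIsOne p E s → IsMinimal p s →
    ∀ s', IsPreparedTransformAt p j b s s' → InSigmaP p s' → ¬ HIsOne p (newBoundary j b E) s'

/-! ### Bridge to the purely inseparable layer (`g = 0`) -/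

/-- With `g = 0`, `p d_i = H_i(f)` (`d_i = a_i / p`). [cite: CossartPiltant2009, ch.1 II.1.2 (g = 0)] -/
theorem pd_of_g_zero (p : ℕ) (s : State σ K) (hg : s.g = 0) (i : σ) : pd p s i = bigH s.f i := by
  unfold pd
  rw [if_pos hg, min_top_right]

/-- With `g = 0`, `p δ(x) = ord₀ f`. [cite: CossartPiltant2009, ch.1 II.1.1 (g = 0)] -/
theorem pdelta_of_g_zero (p : ℕ) (s : State σ K) (hg : s.g = 0) : pdelta p s = ordZero s.f := by
  unfold pdelta
  rw [if_pos hg, min_top_right]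

/-- With `g = 0` the `ε` of this file is the `ε` of the `G = 0` layer (`PointBlowup.epsilon`) of the
residual `F = f`, whatever exceptional multiplicities `r` are carried along.
[cite: CossartPiltant2009, ch.1 II.3.3 (g = 0)] [cite: CossartPiltant2019, Def. 2.10] -/
theorem epsilonAS_of_g_zero (p : ℕ) (E : Finset σ) (s : State σ K) (hg : s.g = 0) (r : σ →₀ ℕ) :
    epsilonAS p E s = epsilon E (⟨s.f, r⟩ : PointBlowup.State σ K) := by
  unfold epsilonAS bigHdeg epsilon
  rw [pdelta_of_g_zero p s hg]
  congr 1
  exact Finset.sum_congr rfl fun i _ => pd_of_g_zero p s hg i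

/-- With `g = 0` every state is in case (ii) (`v_δ(g) > 1` vacuously): `Ω = (ν, 2)`.
[cite: CossartPiltant2009, ch.1 II.4 (ii)] -/
theorem caseII_of_g_zero (p : ℕ) (s : State σ K) (hg : s.g = 0) : CaseII p s := by
  unfold CaseII GTight
  intro h
  exact h.1 hg

end ArtinSchreier

end PointBlowup

end Literature.AlgebraicGeometry.Resolution

end
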